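import Summits.ValiantsHypothesis.ValiantsHypothesis.Theorems.SymPencilPerFourExoticNoSixSquares
import Summits.ValiantsHypothesis.ValiantsHypothesis.Theorems.SymPencilPerFourExoticElemRankEight
import Summits.ValiantsHypothesis.ValiantsHypothesis.Theorems.SymPencilPerFourSixDimCross

/-!
# Route `SymPencil` — row `r = 10` of the size-`28` table: the threshold-shifted declarations of
# `SymPencilPerFourExoticNoSixSquares` (`--supports` stmt-ValiantsHypothesis-5674 `SdcSuperquadratic`; rung currency only)

The declarations below (suffix `_m28`) are those of the landed `…Theorems.SymPencilPerFourExoticNoSixSquares` whose meaning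
changes when its numerical thresholds move by one unit — `Fin 6 → Fin 7` square families /
`|ι'| ≤ 26 → ≤ 27` / `m ≤ 27 → m ≤ 28`, as applicable — with proofs VERBATIM; unchanged
declarations are used from the original module by name (same namespace).  Why it elaborates
(m = 28 table audit, val-lit-p6 g17, 2026-08-29; reader of record val-idea-crit-5 g4, probe P31):
the leaves of the `(10, 6)` chain are stated for `card ι < 8` / `< 9`, and every size lever reads
`4·rk bL ≤ 2·dim K + |ι'|` through integer division — one unit of slack throughout.  The `_m28`
statements imply the landed ones.

Honest framing: part of ONE row (cell `(10, 6, 7)`) of the size-`28` table; nothing about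
`sdc(per_4)` follows here; `28 ≤ sdc(per_4) ≤ 29` of record, the crux `SdcSuperquadratic` and
`VP ≠ VNP` untouched.  Credit: mathematics and proof text of `SymPencilPerFourExoticNoSixSquares` (its authors); this file only
moves the bound.  No definitions, no named facts. [folklore]
-/

noncomputable section

-- single-conjunct layout: Sub = Summit, duplicated namespace component intended
set_option linter.dupNamespace false

namespace Summit.ValiantsHypothesis.ValiantsHypothesis.Theorems.SymPencilPerFourExoticNoSixSquares

open Matrix MvPolynomial Finset Module
open Literature.Computability.AlgebraicComplexity
open Summit.ValiantsHypothesis.ValiantsHypothesis.Theorems.SymPencilPerFourBlocks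
open Summit.ValiantsHypothesis.ValiantsHypothesis.Theorems.SymPencilPerFourTwoRowsRadical
open Summit.ValiantsHypothesis.ValiantsHypothesis.Theorems.SymPencilPerFourSixDimCross
open Summit.ValiantsHypothesis.ValiantsHypothesis.Theorems.SymPencilPerFourExoticElemRankEight

variable {K : Type*} [Field K]

/-! ### Transport of the swapped property to a normalised position -/

/-! ### The four exotic types -/

section Types

variable [CharZero K] (W : Submodule K (Fin 4 × Fin 4 → K))

/-- `V_λ` (rows): contains the permuted exotic element `Y₀(α, β, α, −β)`. [folklore] -/
theorem false_of_vLambdaRows_m28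
    (hP : ∀ y ∈ W, ∃ (c : Fin 7 → K) (Λ : Fin 7 → ((Fin 4 × Fin 4 → K) →ₗ[K] K)),
      ∀ u : Fin 4 × Fin 4 → K, ∃ e₀ e₁ : K, ∀ s : K,
        eval (u + s • y) (perPoly (Fin 4) K) = e₀ + s * e₁ + s ^ 2 * ∑ k, c k * (Λ k u) ^ 2)
    (ρ γ : Equiv.Perm (Fin 4)) (α β : K) (hα : α ≠ 0) (hβ : β ≠ 0)
    (hW : ∀ x : Fin 4 × Fin 4 → K, x ∈ W ↔
      ((∀ j, x (ρ 0, j) = 0) ∧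
       (∃ s : K, ∀ j, x (ρ 2, γ j) = s * ![α, β, 0, 0] j) ∧
       (∃ t : K, ∀ j, x (ρ 3, γ j) = t * ![α, -β, 0, 0] j))) : False := by
  classical
  set Y₀ : Fin 4 × Fin 4 → K := fun p =>
    if p = (1, 0) then (1 : K) else if p = (1, 2) then 1 else if p = (1, 3) then 1
    else if p = (2, 0) then α else if p = (2, 1) then β
    else if p = (3, 0) then α else if p = (3, 1) then -β else 0 with hY₀
  set x : Fin 4 × Fin 4 → K := fun p => Y₀ (ρ.symm p.1, γ.symm p.2) with hx
  have hxW : x ∈ W := by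
    rw [hW]
    refine ⟨fun j => ?_, ⟨1, fun j => ?_⟩, ⟨1, fun j => ?_⟩⟩
    · simp only [hx, hY₀, Equiv.symm_apply_apply, Prod.mk.injEq]
      simp
    · simp only [hx, Equiv.symm_apply_apply]
      fin_cases j <;> simp [hY₀]
    · simp only [hx, Equiv.symm_apply_apply]
      fin_cases j <;> simp [hY₀]
  have hY : (fun p : Fin 4 × Fin 4 => x (ρ p.1, γ p.2)) = Y₀ := by
    funext p
    simp [hx]
  obtain ⟨c, Λ, h⟩ := (hY ▸ transport_rows ρ γ (hP x hxW) :)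
  refine not_sqFamilySwap_exoticElem α β α (-β) (neg_ne_zero.2 hβ) ?_ (ι := Fin 7) (by simp) c Λ
    (by simpa only [hY₀] using h)
  have : α * -β - β * α = -(2 * (α * β)) := by ring
  rw [this, neg_ne_zero]
  exact mul_ne_zero two_ne_zero (mul_ne_zero hα hβ)
/-- `V^gr` (rows): contains the permuted exotic element `Y₀(1, 1, c₀, −c₀)`. [folklore] -/
theorem false_of_vGraphRows_m28
    (hP : ∀ y ∈ W, ∃ (c : Fin 7 → K) (Λ : Fin 7 → ((Fin 4 × Fin 4 → K) →ₗ[K] K)),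
      ∀ u : Fin 4 × Fin 4 → K, ∃ e₀ e₁ : K, ∀ s : K,
        eval (u + s • y) (perPoly (Fin 4) K) = e₀ + s * e₁ + s ^ 2 * ∑ k, c k * (Λ k u) ^ 2)
    (ρ γ : Equiv.Perm (Fin 4)) (c₀ : K) (hc₀ : c₀ ≠ 0)
    (hW : ∀ x : Fin 4 × Fin 4 → K, x ∈ W ↔
      ((∀ j, x (ρ 0, j) = 0) ∧
       x (ρ 2, γ 2) = 0 ∧ x (ρ 2, γ 3) = 0 ∧ x (ρ 3, γ 2) = 0 ∧ x (ρ 3, γ 3) = 0 ∧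
       x (ρ 3, γ 0) = c₀ * x (ρ 2, γ 0) ∧ x (ρ 3, γ 1) = -(c₀ * x (ρ 2, γ 1)))) : False := by
  classical
  set Y₀ : Fin 4 × Fin 4 → K := fun p =>
    if p = (1, 0) then (1 : K) else if p = (1, 2) then 1 else if p = (1, 3) then 1
    else if p = (2, 0) then (1 : K) else if p = (2, 1) then (1 : K)
    else if p = (3, 0) then c₀ else if p = (3, 1) then -c₀ else 0 with hY₀
  set x : Fin 4 × Fin 4 → K := fun p => Y₀ (ρ.symm p.1, γ.symm p.2) with hx
  have hxW : x ∈ W := by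
    rw [hW]
    refine ⟨fun j => ?_, ?_, ?_, ?_, ?_, ?_, ?_⟩
    · simp only [hx, hY₀, Equiv.symm_apply_apply, Prod.mk.injEq]
      simp
    all_goals simp [hx, hY₀]
  have hY : (fun p : Fin 4 × Fin 4 => x (ρ p.1, γ p.2)) = Y₀ := by
    funext p
    simp [hx]
  obtain ⟨c, Λ, h⟩ := (hY ▸ transport_rows ρ γ (hP x hxW) :)
  refine not_sqFamilySwap_exoticElem (1 : K) 1 c₀ (-c₀) (neg_ne_zero.2 hc₀) ?_ (ι := Fin 7)
    (by simp) c Λ (by simpa only [hY₀] using h)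
  have : (1 : K) * -c₀ - 1 * c₀ = -(2 * c₀) := by ring
  rw [this, neg_ne_zero]
  exact mul_ne_zero two_ne_zero hc₀
/-- `V_λ` (columns): contains the transposed-permuted exotic element `Y₀(α, β, α, −β)`.
[folklore] -/
theorem false_of_vLambdaCols_m28
    (hP : ∀ y ∈ W, ∃ (c : Fin 7 → K) (Λ : Fin 7 → ((Fin 4 × Fin 4 → K) →ₗ[K] K)),
      ∀ u : Fin 4 × Fin 4 → K, ∃ e₀ e₁ : K, ∀ s : K,
        eval (u + s • y) (perPoly (Fin 4) K) = e₀ + s * e₁ + s ^ 2 * ∑ k, c k * (Λ k u) ^ 2)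
    (ρ γ : Equiv.Perm (Fin 4)) (α β : K) (hα : α ≠ 0) (hβ : β ≠ 0)
    (hW : ∀ x : Fin 4 × Fin 4 → K, x ∈ W ↔
      ((∀ i, x (i, γ 0) = 0) ∧
       (∃ s : K, ∀ i, x (ρ i, γ 2) = s * ![α, β, 0, 0] i) ∧
       (∃ t : K, ∀ i, x (ρ i, γ 3) = t * ![α, -β, 0, 0] i))) : False := by
  classical
  set Y₀ : Fin 4 × Fin 4 → K := fun p =>
    if p = (1, 0) then (1 : K) else if p = (1, 2) then 1 else if p = (1, 3) then 1
    else if p = (2, 0) then α else if p = (2, 1) then β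
    else if p = (3, 0) then α else if p = (3, 1) then -β else 0 with hY₀
  set x : Fin 4 × Fin 4 → K := fun p => Y₀ (γ.symm p.2, ρ.symm p.1) with hx
  have hxW : x ∈ W := by
    rw [hW]
    refine ⟨fun i => ?_, ⟨1, fun i => ?_⟩, ⟨1, fun i => ?_⟩⟩
    · simp only [hx, hY₀, Equiv.symm_apply_apply, Prod.mk.injEq]
      simp
    · simp only [hx, Equiv.symm_apply_apply]
      fin_cases i <;> simp [hY₀]
    · simp only [hx, Equiv.symm_apply_apply]
      fin_cases i <;> simp [hY₀]
  have hY : (fun p : Fin 4 × Fin 4 => x (ρ p.2, γ p.1)) = Y₀ := by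
    funext p
    simp [hx]
  obtain ⟨c, Λ, h⟩ := (hY ▸ transport_cols ρ γ (hP x hxW) :)
  refine not_sqFamilySwap_exoticElem α β α (-β) (neg_ne_zero.2 hβ) ?_ (ι := Fin 7) (by simp) c Λ
    (by simpa only [hY₀] using h)
  have : α * -β - β * α = -(2 * (α * β)) := by ring
  rw [this, neg_ne_zero]
  exact mul_ne_zero two_ne_zero (mul_ne_zero hα hβ)
/-- `V^gr` (columns): contains the transposed-permuted exotic element `Y₀(1, 1, c₀, −c₀)`.
[folklore] -/
theorem false_of_vGraphCols_m28
    (hP : ∀ y ∈ W, ∃ (c : Fin 7 → K) (Λ : Fin 7 → ((Fin 4 × Fin 4 → K) →ₗ[K] K)),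
      ∀ u : Fin 4 × Fin 4 → K, ∃ e₀ e₁ : K, ∀ s : K,
        eval (u + s • y) (perPoly (Fin 4) K) = e₀ + s * e₁ + s ^ 2 * ∑ k, c k * (Λ k u) ^ 2)
    (ρ γ : Equiv.Perm (Fin 4)) (c₀ : K) (hc₀ : c₀ ≠ 0)
    (hW : ∀ x : Fin 4 × Fin 4 → K, x ∈ W ↔
      ((∀ i, x (i, γ 0) = 0) ∧
       x (ρ 2, γ 2) = 0 ∧ x (ρ 3, γ 2) = 0 ∧ x (ρ 2, γ 3) = 0 ∧ x (ρ 3, γ 3) = 0 ∧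
       x (ρ 0, γ 3) = c₀ * x (ρ 0, γ 2) ∧ x (ρ 1, γ 3) = -(c₀ * x (ρ 1, γ 2)))) : False := by
  classical
  set Y₀ : Fin 4 × Fin 4 → K := fun p =>
    if p = (1, 0) then (1 : K) else if p = (1, 2) then 1 else if p = (1, 3) then 1
    else if p = (2, 0) then (1 : K) else if p = (2, 1) then (1 : K)
    else if p = (3, 0) then c₀ else if p = (3, 1) then -c₀ else 0 with hY₀
  set x : Fin 4 × Fin 4 → K := fun p => Y₀ (γ.symm p.2, ρ.symm p.1) with hx
  have hxW : x ∈ W := by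
    rw [hW]
    refine ⟨fun i => ?_, ?_, ?_, ?_, ?_, ?_, ?_⟩
    · simp only [hx, hY₀, Equiv.symm_apply_apply, Prod.mk.injEq]
      simp
    all_goals simp [hx, hY₀]
  have hY : (fun p : Fin 4 × Fin 4 => x (ρ p.2, γ p.1)) = Y₀ := by
    funext p
    simp [hx]
  obtain ⟨c, Λ, h⟩ := (hY ▸ transport_cols ρ γ (hP x hxW) :)
  refine not_sqFamilySwap_exoticElem (1 : K) 1 c₀ (-c₀) (neg_ne_zero.2 hc₀) ?_ (ι := Fin 7)
    (by simp) c Λ (by simpa only [hY₀] using h)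
  have : (1 : K) * -c₀ - 1 * c₀ = -(2 * c₀) := by ring
  rw [this, neg_ne_zero]
  exact mul_ne_zero two_ne_zero hc₀
end Types

/-- **LEAF 3 — THE EXOTICS CARRY NO PER-DIRECTION SIX-SQUARE FAMILY**, verbatim from
`Cruxes/SdcSuperquadratic/Lines/sing_six_classification.lean` with `VLambdaRows`, `VGraphRows`,
`VLambdaCols`, `VGraphCols`, `PerDirSix` unfolded. [folklore] -/
theorem stub_exoticNoSixSquares_m28 [CharZero K] :
    ∀ W : Submodule K (Fin 4 × Fin 4 → K),
      ((∃ (ρ γ : Equiv.Perm (Fin 4)) (α β : K), α ≠ 0 ∧ β ≠ 0 ∧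
          ∀ x : Fin 4 × Fin 4 → K, x ∈ W ↔
            ((∀ j, x (ρ 0, j) = 0) ∧
             (∃ s : K, ∀ j, x (ρ 2, γ j) = s * ![α, β, 0, 0] j) ∧
             (∃ t : K, ∀ j, x (ρ 3, γ j) = t * ![α, -β, 0, 0] j))) ∨
       (∃ (ρ γ : Equiv.Perm (Fin 4)) (c₀ : K), c₀ ≠ 0 ∧
          ∀ x : Fin 4 × Fin 4 → K, x ∈ W ↔
            ((∀ j, x (ρ 0, j) = 0) ∧
             x (ρ 2, γ 2) = 0 ∧ x (ρ 2, γ 3) = 0 ∧ x (ρ 3, γ 2) = 0 ∧ x (ρ 3, γ 3) = 0 ∧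
             x (ρ 3, γ 0) = c₀ * x (ρ 2, γ 0) ∧ x (ρ 3, γ 1) = -(c₀ * x (ρ 2, γ 1)))) ∨
       (∃ (ρ γ : Equiv.Perm (Fin 4)) (α β : K), α ≠ 0 ∧ β ≠ 0 ∧
          ∀ x : Fin 4 × Fin 4 → K, x ∈ W ↔
            ((∀ i, x (i, γ 0) = 0) ∧
             (∃ s : K, ∀ i, x (ρ i, γ 2) = s * ![α, β, 0, 0] i) ∧
             (∃ t : K, ∀ i, x (ρ i, γ 3) = t * ![α, -β, 0, 0] i))) ∨
       (∃ (ρ γ : Equiv.Perm (Fin 4)) (c₀ : K), c₀ ≠ 0 ∧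
          ∀ x : Fin 4 × Fin 4 → K, x ∈ W ↔
            ((∀ i, x (i, γ 0) = 0) ∧
             x (ρ 2, γ 2) = 0 ∧ x (ρ 3, γ 2) = 0 ∧ x (ρ 2, γ 3) = 0 ∧ x (ρ 3, γ 3) = 0 ∧
             x (ρ 0, γ 3) = c₀ * x (ρ 0, γ 2) ∧ x (ρ 1, γ 3) = -(c₀ * x (ρ 1, γ 2))))) →
      ¬ (∀ y ∈ W, ∃ (c : Fin 7 → K) (Λ : Fin 7 → ((Fin 4 × Fin 4 → K) →ₗ[K] K)),
          ∀ u : Fin 4 × Fin 4 → K, ∃ e₀ e₁ : K, ∀ s : K,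
            eval (u + s • y) (perPoly (Fin 4) K) = e₀ + s * e₁ + s ^ 2 * ∑ k, c k * (Λ k u) ^ 2) := by
  intro W hW hP
  rcases hW with ⟨ρ, γ, α, β, hα, hβ, hW⟩ | ⟨ρ, γ, c₀, hc₀, hW⟩ | ⟨ρ, γ, α, β, hα, hβ, hW⟩ |
    ⟨ρ, γ, c₀, hc₀, hW⟩
  · exact false_of_vLambdaRows_m28 W hP ρ γ α β hα hβ hW
  · exact false_of_vGraphRows_m28 W hP ρ γ c₀ hc₀ hW
  · exact false_of_vLambdaCols_m28 W hP ρ γ α β hα hβ hW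
  · exact false_of_vGraphCols_m28 W hP ρ γ c₀ hc₀ hW
end Summit.ValiantsHypothesis.ValiantsHypothesis.Theorems.SymPencilPerFourExoticNoSixSquares

end
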